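import Summits.Ventures.HSemireg.WedgeHankelRecurrencePowerSums
import Mathlib.FieldTheory.SplittingField.Construction

/-!
# Venture HSemireg — THE SYMBOL UNDER BASE CHANGE AND IN A SPLITTING FIELD: `dualSeq` commutes with field embeddings (`dualSeq (φ m) (φ a) = φ ∘ dualSeq m a`), the MULTISET form of N80
# **`dualSeq (∏_{λ ∈ s} (X − λ)) (∏)′ = (Σ_{λ ∈ s} λ^j)_j`** (repetitions allowed), hence for `m` monic and any field embedding `φ` under which `m` splits
# **`φ (dualSeq m m′ j) = Σ_{λ ∈ roots(φ m)} λ^j`** — the `j`-th value of the symbol `m′/m` IS the `j`-th POWER SUM of the roots of `m` counted with multiplicity, in particular in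
# `m.SplittingField`; with N103 (`trace (M_X^j) = dualSeq m m′ j`) this is «`trace (C^j) = Σ λ_i^j`» for the companion matrix, which Mathlib states only for `j = 1` (`trace_eq_sum_roots_charpoly`)

HONEST FRAMING. Part of the Lean index of the computation cell `pub-hsemireg` (seat p10 gen 31, Sunday typer «UNIFORM-IN-n»).
LINEAR ALGEBRA OF HANKEL (catalecticant) MATRICES and of polynomials over a field ONLY (`Polynomial.map`, `Polynomial.modByMonic`, `Polynomial.roots`, `Polynomial.Splits`, `SplittingField`): no
variety, no cohomology theory, no sheaf, no Ext group and no semiregularity map is constructed here; nothing here says that HC / HC_CM / HC_AV holds; no Literature fact is declared or used.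
Custodian versions as in `WedgeHankelSiegelIdeal` (1/3).

WHAT IS IN THE TREE.  N32: `dualSeq_apply`.  N45 (`WedgeHankelRecurrenceSymbol`): `dualSeq_add_dualSeq` (addition of symbols).  N80 (`WedgeHankelRecurrencePowerSums`): `dualSeq_X_sub_C_one`, `dualSeq_one_zero`,
`dualSeq_prod_X_sub_C_derivative` (the `Fin`-indexed split case).  N94 (`WedgeHankelRecurrenceResultant`): `mulResidueMat_map` (the matrix-side base change; not used).  Mathlib: `Polynomial.map_modByMonic`,
`coeff_map`, `natDegree_map`, `derivative_map`, `Splits.eq_prod_roots_of_monic`, `SplittingField.splits`, `Multiset.induction_on`.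
THIS FILE (namespace `Summit.Ventures.HSemireg.Wedge.HankelOuter` continued; PLAIN on N80; 0 definitions):
* §663 **`dualSeq_map`** (base change), **`dualSeq_multiset_prod_X_sub_C_derivative`** (multiset power sums), **`map_dualSeq_derivative_eq_sum_roots_pow`** (`φ (dualSeq m m′ j) = ((m.map φ).roots.map (· ^ j)).sum`
  when `m.map φ` splits), `dualSeq_derivative_eq_sum_roots_pow` (`m` split over `K` itself), `algebraMap_dualSeq_derivative_eq_sum_roots_pow` (in `m.SplittingField`).
Nothing Ext-side.  New names only.
-/

open Module Polynomial
open scoped Matrix Polynomial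

namespace Summit.Ventures.HSemireg.Wedge.HankelOuter

open Summit.Ventures.HSemireg.Wedge Summit.Ventures.HSemireg.Wedge.Hankel

variable (K : Type*) [Field K]

/-! ## §663. Base change of the symbol and the power sums in a splitting field -/

/-- **The symbol commutes with field embeddings: `dualSeq (m.map φ) (a.map φ) = φ ∘ dualSeq m a`** (`m` monic; `modByMonic` and coefficients commute with `map`). -/
theorem dualSeq_map {L : Type*} [Field L] (φ : K →+* L) {m : K[X]} (hm : m.Monic) (a : K[X]) :
    dualSeq L (m.map φ) (a.map φ) = fun j => φ (dualSeq K m a j) := by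
  funext j
  rw [dualSeq_apply, dualSeq_apply, Polynomial.natDegree_map, ← Polynomial.coeff_map, Polynomial.map_modByMonic φ hm, Polynomial.map_mul, Polynomial.map_pow, Polynomial.map_X]

/-- **Multiset power sums: `dualSeq (∏_{λ ∈ s} (X − C λ)) (∏_{λ ∈ s} (X − C λ))′ = (Σ_{λ ∈ s} λ^j)_j`** for every multiset `s` of nodes (repetitions allowed) — N80's `Fin`-indexed partial-fraction
induction `m′/m = Σ 1/(X − λ)` redone over `Multiset`, the form in which `Polynomial.roots` delivers the nodes. -/
theorem dualSeq_multiset_prod_X_sub_C_derivative (s : Multiset K) :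
    dualSeq K (s.map fun c => Polynomial.X - C c).prod (derivative (s.map fun c => Polynomial.X - C c).prod) = fun j => (s.map fun c => c ^ j).sum := by
  induction s using Multiset.induction_on with
  | empty =>
    funext j
    rw [Multiset.map_zero, Multiset.prod_zero, Polynomial.derivative_one, dualSeq_one_zero, Multiset.map_zero, Multiset.sum_zero, Pi.zero_apply]
  | cons c s ih =>
    have hm : (s.map fun c => Polynomial.X - C c).prod.Monic := Polynomial.monic_multiset_prod_of_monic _ _ fun c _ => Polynomial.monic_X_sub_C c
    funext j
    rw [Multiset.map_cons, Multiset.prod_cons, Polynomial.derivative_mul, Polynomial.derivative_X_sub_C, mul_comm (Polynomial.X - C c) (derivative _),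
      ← dualSeq_add_dualSeq K (Polynomial.monic_X_sub_C c) hm, dualSeq_X_sub_C_one, ih, Multiset.map_cons, Multiset.sum_cons]
    rfl

/-- **The symbol `m′/m` is the power-sum sequence of the roots: `φ (dualSeq m m′ j) = Σ_{λ ∈ roots (m.map φ)} λ^j`** for `m` monic and any field embedding `φ : K → L` under which `m` splits
(roots counted with multiplicity). -/
theorem map_dualSeq_derivative_eq_sum_roots_pow {L : Type*} [Field L] (φ : K →+* L) {m : K[X]} (hm : m.Monic) (hs : (m.map φ).Splits) (j : ℕ) :
    φ (dualSeq K m (derivative m) j) = ((m.map φ).roots.map fun c => c ^ j).sum := by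
  have h1 := congrFun (dualSeq_map K φ hm (derivative m)) j
  rw [← Polynomial.derivative_map] at h1
  rw [← h1]
  have hP := hs.eq_prod_roots_of_monic (hm.map φ)
  have h2 := congrFun (dualSeq_multiset_prod_X_sub_C_derivative L (m.map φ).roots) j
  rw [← hP] at h2
  exact h2

/-- The split case over `K` itself: `dualSeq m m′ j = Σ_{λ ∈ m.roots} λ^j` (`m` monic and split). -/
theorem dualSeq_derivative_eq_sum_roots_pow {m : K[X]} (hm : m.Monic) (hs : m.Splits) (j : ℕ) :
    dualSeq K m (derivative m) j = (m.roots.map fun c => c ^ j).sum := by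
  have h := map_dualSeq_derivative_eq_sum_roots_pow K (RingHom.id K) hm (by rwa [Polynomial.map_id]) j
  rwa [Polynomial.map_id, RingHom.id_apply] at h

/-- In the splitting field: `algebraMap K m.SplittingField (dualSeq m m′ j) = Σ_{λ ∈ roots} λ^j` (`m` monic). -/
theorem algebraMap_dualSeq_derivative_eq_sum_roots_pow {m : K[X]} (hm : m.Monic) (j : ℕ) :
    algebraMap K m.SplittingField (dualSeq K m (derivative m) j) = ((m.map (algebraMap K m.SplittingField)).roots.map fun c => c ^ j).sum :=
  map_dualSeq_derivative_eq_sum_roots_pow K (algebraMap K m.SplittingField) hm (SplittingField.splits m) j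

end Summit.Ventures.HSemireg.Wedge.HankelOuter
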